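import Literature.AlgebraicGeometry.ShimuraVarieties.UnitaryCurveSpecialPairReciprocityCentralTwist   -- ★ (S2a) p849704∕p849722 (LA6-p02): the head for SOME correspondent; §1 reflex lemmas
import HarnessLib

/-!
# Special-pair reciprocity on the unitary Shimura CURVE with the central torus factor — the datum AT A GIVEN reflex idèle `u`
# ([Milne 2005] Def. 12.8 (60)–(62) at the special pair of [Deligne 1971] 5.11; [Shimura 1998] §18.6)

Topic `AlgebraicGeometry/ShimuraVarieties`; namespace `…ShimuraVarieties.UnitaryCurve.AuxV` (as ★ `UnitaryCurveSpecialPairReciprocityCentralTwist`).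
THEOREMS ONLY (no definition, no named fact, no instance, no `sorry`; net Literature debt 0).  Cell `hodgecm-mathlib` (D-0151), FLOOR 0, P6 «MOD
programme», X-leaf `stub_ESHEET` («the sheet line», E-pen A-p01 (g28)), organ (S2a) in the currency the (S8) closer needs after the junction pin
«`z · t(sE) = 1` for SOME exact correspondent `sE` of `γ̃`» (A-p01 (g28) 2026-09-02T06:45:14Z): the closer's arithmetic side ((S6)∕(S7)) CHOOSES the
`E♯`-idèle `sE` corresponding to `γ̃` (moving it inside `ker art` to get `t(sE) ≡ 1 mod N`, `[t(sE)]⁻¹ = 𝔞` integral), so the geometric side must read the CM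
reciprocity datum of the special point AT THAT `sE` — whereas ★ `exists_siegelRecipDatum_centralTwist` produces its own correspondent under `∃ sE`.
Reading its proof shows the datum `(c, Φ′, t, d♯)` is built for an ARBITRARY `E♯`-idèle `u` (no `σ` enters until the Artin correspondence of the norm
`N_{E♯∕F} u` is recorded): this file states exactly that — **`exists_siegelRecipDatum_centralTwist_at`**: for EVERY `u ∈ 𝔸_{E♯,f}^×` and every special
`w`, a frame-pinned CM structure `c` special for `J(ι₁w)` of types `Φ′ = (Φ, Ψ)`, the torus element `t = N_{E♯,Φ}(u)`, and an `r_w(N_{E♯∕F} u)`-twist `d♯`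
with `ũ_V(d♯, t) = c.cmRecipMatrix Φ′ E♯ u`, the type-norm identity `N_{E♯,Ψ}(u) = t · (s̄′∕s′)` (`s′ = N_{E♯∕F} u`, exported under `∃ s′` with «`s′ ↔ σ` along `ι₁` for EVERY `σ ↔ u`», ★ `isArtinCorrespondent_finiteIdeleRelNorm`) and the SPLIT identity
`ũ_V(d♯,t)·ũ_V(a,1) = ũ_V(d♯·a,1)·ũ_V(1,t)` for ALL `a` (one `d♯` for all `a`).  For `σ` fixing `E♯` with `u ↔ σ`, ★ `isArtinCorrespondent_finiteIdeleRelNorm`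
makes `s′ ↔ σ` along `ι₁`, and ★ `shimuraSetGS_mk_twist_eq_of_isArtinCorrespondent'` compares `d♯` with any other twist — recorded as the corollary
**`exists_siegelRecipDatum_centralTwist_of_correspondent`** (the head of ★ (S2a) with `sE := u` GIVEN).  PROOF = the proof of ★
`exists_siegelRecipDatum_centralTwist` verbatim with `u` a binder (LA6-p02 (g2)'s construction; this file only re-quantifies it).
HONEST LABEL: HC_CM is proved only modulo the 2 remaining named inputs (hLiu418 24832, h413 24833) until rung 0 closes; this file is generic and count-neutral.

## References
* [Milne2005ShimuraVarieties] J. S. Milne, *Introduction to Shimura varieties* (2005), Def. 12.8 (59)–(62) p. 114; §11 Thm. 11.2 p. 108.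
* [Deligne1971TravauxShimura] P. Deligne, *Travaux de Shimura* (1971), 4.18 p. 150, 5.11 p. 158.
* [Shimura1998] G. Shimura, *Abelian Varieties with Complex Multiplication and Modular Functions* (1998), §8.3 Prop. 28, §18.6 p. 128.
* [RapoportSmithlingZhang2020Diagonal] M. Rapoport, B. Smithling, W. Zhang, Compos. Math. 156 (2020), Remark 3.1, (3.3), (3.10).
* [Liu2021] Y. Liu, *Fourier–Jacobi cycles and arithmetic relative trace formula* (2021), App. C Lem. C.14 and Rem. C.15 (p. 113).
-/

set_option autoImplicit false

noncomputable section

open Matrix NumberField IsDedekindDomain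
open scoped TensorProduct

namespace Literature.AlgebraicGeometry.ShimuraVarieties

namespace UnitaryCurve

namespace AuxV

open Literature.AlgebraicGeometry.ModuliOfAbelianVarieties
open Literature.NumberTheory.ComplexMultiplication (traceField reflexNormFiniteIdele ratFiniteAdeleTensorEquiv)
open Literature.AlgebraicGeometry.Motives (CMType)
open Literature.NumberTheory.Automorphic Literature.NumberTheory.Automorphic.UnitaryGroup
open Literature.NumberTheory.AdelicBaseChange (finiteIdeleRelNorm)
open Literature.AlgebraicGeometry.ShimuraVarieties.UnitaryCanonicalModel (IsArtinCorrespondent recipFactor IsDiagTwistGS ShimuraSetGS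
  exists_isDiagTwistGS_recipFactor' conj_apply_eq_of_transpose_map_eq hermForm_conj_symm
  shimuraSetGS_mk_twist_eq_of_isArtinCorrespondent')
open Literature.AlgebraicGeometry.ShimuraVarieties.UnitaryCanonicalModel.Aux (torusFinAdelic reflexField numberField_reflexField
  toReflexField traceField_le_reflexField apply_mem_reflexField reflexNormFiniteIdele_mem_torusFinAdelic_of_le isTotallyComplex_reflexField
  artinSurjectiveReflex isArtinCorrespondent_finiteIdeleRelNorm exists_cmType_swap traceField_le_of_swap reflexNormFiniteIdele_swap_recipFactor
  finAdeleToTensor ratBasis)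

variable {F : Type} [Field F] [NumberField F] [IsCMField F]

omit [NumberField F] [IsCMField F] in
/-- The Gram entries of a frame: `(ᵗc(b)·J·b)_{ik} = ⟨b e_i, b e_k⟩_J`. [cite: Deligne1979ShimuraVarieties, 2.3.9 (PDF p. 32)] -/
private theorem transpose_map_mul_mul_apply' (c : F →+* F) (J b : Matrix (Fin 2) (Fin 2) F) (i k : Fin 2) :
    ((b.map c)ᵀ * J * b) i k = hermForm c J (fun l => b l i) (fun l => b l k) := by
  simp only [Matrix.mul_apply, Matrix.transpose_apply, Matrix.map_apply, hermForm, dotProduct, Matrix.mulVec,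
    Function.comp_apply, Finset.sum_mul, Finset.mul_sum, mul_assoc]
  rw [Finset.sum_comm]

/-- **THE CM RECIPROCITY DATUM OF A SPECIAL POINT AT A GIVEN REFLEX IDÈLE `u`** (organ (S2a) re-quantified): data as in ★
`exists_siegelRecipDatum_centralTwist` (Hermitian `J⋆` on `F²`, `ι₁ ∈ Φ`, the symplectic frame `Fr`, a Hodge-embedding datum `J` landing in `S^±`, the
special-pair property `hJsp` BY VALUE).  Conclusion, for EVERY `E♯`-idèle `u` (`E♯ = ι₁(F)·E*(Φ)`) and every special `w`: a CM structure `c` by `F × F`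
SPECIAL for `J(ι₁ w)` of types `Φ′ = (Φ, Ψ)`, `Ψ = Φ ∖ {ι₁} ∪ {ῑ₁}`, PINNED on the frame, with `E*(Φ′ᵢ) ⊆ E♯`; the torus element `t = N_{E♯,Φ}(u)`; a twist `d♯`
of `r_w(N_{E♯∕F} u)` with `ũ_V(d♯, t) = c.cmRecipMatrix Φ′ E♯ u` (the element of [Milne2005ShimuraVarieties] (62)), the TYPE-NORM IDENTITY
`N_{E♯,Ψ}(u) = t · (s̄′∕s′)`, `s′ = N_{E♯∕F} u`, and the SPLIT IDENTITY `ũ_V(d♯,t)·ũ_V(a,1) = ũ_V(d♯·a,1)·ũ_V(1,t)` for ALL `a`.  No `σ`, no level.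
[cite: Milne2005ShimuraVarieties, Def. 12.8 (59)–(62) p. 114, §11 Thm. 11.2 p. 108] [cite: Deligne1971TravauxShimura, 4.18 p. 150 and 5.11 p. 158]
[cite: Shimura1998, §18.6 p. 128] [cite: RapoportSmithlingZhang2020Diagonal, Remark 3.1 p. 9, (3.3), (3.10)] -/
theorem exists_siegelRecipDatum_centralTwist_at (ι₁ : F →+* ℂ) (Jstar : Matrix (Fin 2) (Fin 2) F)
    (hJ : (Jstar.map (IsCMField.complexConj F))ᵀ = Jstar) (Φ : CMType F) (hΦ : ι₁ ∈ Φ.1) {ξ : F} {g : ℕ} {δ : Fin g → ℕ}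
    (Fr : SymplecticFrameV F (RingHom.id F) Jstar ξ g δ)
    (J : (Fin 2 → ℂ) → Matrix (Fin g ⊕ Fin g) (Fin g ⊕ Fin g) ℝ)
    (hJC : ∀ v : Fin 2 → ℂ, v ∈ negCone (Jstar.map ι₁) → J v ∈ C0pm δ)
    (hJsp : ∀ (w : Fin 2 → F) (hw : (fun i => ι₁ (w i)) ∈ negCone (Jstar.map ι₁)) (b : GL (Fin 2) F),
      (fun i => (b : Matrix (Fin 2) (Fin 2) F) i 1) = w →
      hermForm (cmConjRingHom F) Jstar (fun i => (b : Matrix (Fin 2) (Fin 2) F) i 0) w = 0 →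
      ∀ c : CMStructure g δ (Fin 2) (fun _ => F),
        (∀ (x : Fin 2 → F) (p : Fin 2) (m : F),
          c.act x (Fr.β (m • (b : Matrix (Fin 2) (Fin 2) F) *ᵥ Pi.single p 1)) =
            Fr.β ((x p * m) • (b : Matrix (Fin 2) (Fin 2) F) *ᵥ Pi.single p 1)) →
        ∀ Φ' : Fin 2 → CMType F, Φ' 0 = Φ →
          (∀ ρ : F →+* ℂ, ρ ∈ (Φ' 1).1 ↔ (ρ ∈ Φ.1 ∧ ρ ≠ ι₁) ∨ ρ = NumberField.ComplexEmbedding.conjugate ι₁) →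
          c.IsSpecial ⟨J (fun i => ι₁ (w i)), hJC _ hw⟩ Φ') :
    haveI : NumberField ↥(reflexField F Φ ι₁) := numberField_reflexField F Φ ι₁
    ∀ (u : (FiniteAdeleRing (𝓞 ↥(reflexField F Φ ι₁)) ↥(reflexField F Φ ι₁))ˣ)
      (w : Fin 2 → F) (hw : (fun i => ι₁ (w i)) ∈ negCone (Jstar.map ι₁)),
        ∃ (c : CMStructure g δ (Fin 2) (fun _ => F)) (Φ' : Fin 2 → CMType F) (t : ↥(torusFinAdelic F))
          (d' : ↥(finAdelic (↥(maximalRealSubfield F)) F (IsCMField.complexConj F) 2 Jstar)),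
          c.IsSpecial ⟨J (fun i => ι₁ (w i)), hJC _ hw⟩ Φ' ∧
          (∀ x : F, c.actMatrix (fun _ => x) = framePV Fr * resMatrix (ratBasis F) (x • (1 : Matrix (Fin 2) (Fin 2) F)) * frameQV Fr) ∧
          Φ' 0 = Φ ∧ (∀ ρ : F →+* ℂ, ρ ∈ (Φ' 1).1 ↔ (ρ ∈ Φ.1 ∧ ρ ≠ ι₁) ∨ ρ = NumberField.ComplexEmbedding.conjugate ι₁) ∧
          (∀ i, traceField (Φ' i) ≤ reflexField F Φ ι₁) ∧
          ((auxToGspFinV Fr (d', t) : GL (Fin g ⊕ Fin g) finAdeleQ) : Matrix (Fin g ⊕ Fin g) (Fin g ⊕ Fin g) finAdeleQ) =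
            c.cmRecipMatrix Φ' (reflexField F Φ ι₁) u ∧
          (t : (FiniteAdeleRing (𝓞 F) F)ˣ) = reflexNormFiniteIdele F Φ (reflexField F Φ ι₁) u ∧
          (∃ s' : (FiniteAdeleRing (𝓞 F) F)ˣ,
            (∀ σ : ℂ ≃+* ℂ, IsArtinCorrespondent ↥(reflexField F Φ ι₁) (algebraMap ↥(reflexField F Φ ι₁) ℂ) u σ →
              IsArtinCorrespondent F ι₁ s' σ) ∧
            IsDiagTwistGS F Jstar w (recipFactor F s') d' ∧
            ((reflexNormFiniteIdele F (Φ' 1) (reflexField F Φ ι₁) u : (FiniteAdeleRing (𝓞 F) F)ˣ) : FiniteAdeleRing (𝓞 F) F) =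
              ((t : (FiniteAdeleRing (𝓞 F) F)ˣ) : FiniteAdeleRing (𝓞 F) F) *
                ratFiniteAdeleTensorEquiv F (finAdeleToTensor F (RingHom.id F) (recipFactor F s'))) ∧
          ∀ a : ↥(finAdelic (↥(maximalRealSubfield F)) F (IsCMField.complexConj F) 2 Jstar),
            auxToGspFinV Fr (d', t) * auxToGspFinV Fr (a, 1) = auxToGspFinV Fr (d' * a, 1) * auxToGspFinV Fr (1, t) := by
  classical
  -- the reflex compositum `E♯ = ι₁(F)·E*(Φ)` and the swapped type `Ψ = Φ^ῑ₁`
  haveI : NumberField ↥(reflexField F Φ ι₁) := numberField_reflexField F Φ ι₁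
  haveI : IsTotallyComplex ↥(reflexField F Φ ι₁) := isTotallyComplex_reflexField F Φ ι₁
  letI : Algebra F ↥(reflexField F Φ ι₁) := (toReflexField F Φ ι₁).toAlgebra
  have hEΦ : traceField Φ ≤ reflexField F Φ ι₁ := traceField_le_reflexField F Φ ι₁
  have hι₁ : NumberField.ComplexEmbedding.conjugate ι₁ ≠ ι₁ := fun h =>
    NumberField.IsTotallyComplex.complexEmbedding_not_isReal ι₁ (NumberField.ComplexEmbedding.isReal_iff.mpr h)
  obtain ⟨Ψ, hΨ⟩ := exists_cmType_swap Φ ι₁ (RingHom.id F) hι₁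
  have hΨE : traceField Ψ ≤ reflexField F Φ ι₁ :=
    traceField_le_of_swap Φ Ψ ι₁ (RingHom.id F) hΨ (reflexField F Φ ι₁) (apply_mem_reflexField F Φ ι₁) hEΦ
  have hJ' : ∀ i k, cmConjRingHom F (Jstar i k) = Jstar k i := conj_apply_eq_of_transpose_map_eq F Jstar hJ
  intro u w hw
  -- the twist `d♯` by `r_w(N u)` and the frame `b = (w′ | w)`
  have hww : hermForm (cmConjRingHom F) Jstar w w ≠ 0 :=
    UnitaryCanonicalModel.hermForm_self_ne_zero_of_embedding_mem_negCone hw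
  obtain ⟨d', hd'⟩ := exists_isDiagTwistGS_recipFactor' F Jstar hJ hww (finiteIdeleRelNorm F ↥(reflexField F Φ ι₁) u)
  have hsymm : ∀ x y : Fin 2 → F, hermForm (cmConjRingHom F) Jstar x y = 0 → hermForm (cmConjRingHom F) Jstar y x = 0 := by
    intro x y hxy
    rw [hermForm_conj_symm F Jstar hJ', hxy, map_zero]
  obtain ⟨-, b₀, -, hb1₀, hperp₀, -⟩ :=
    exists_frame_formCongr_eq_finSum_of_hermForm_self_ne_zero (cmConjRingHom F) (n := 1) Jstar hsymm w hww
  have key : ∃ b : GL (Fin 2) F, (fun i => (b : Matrix (Fin 2) (Fin 2) F) i 1) = w ∧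
      hermForm (cmConjRingHom F) Jstar (fun i => (b : Matrix (Fin 2) (Fin 2) F) i 0) w = 0 :=
    ⟨b₀, funext fun i => hb1₀ i, hsymm _ _ (hperp₀ 0)⟩
  obtain ⟨b, hb1', hperp⟩ := key
  have hperp0 : hermForm (cmConjRingHom F) Jstar w (fun i => (b : Matrix (Fin 2) (Fin 2) F) i 0) = 0 := hsymm _ _ hperp
  have hJid : Jstar.map (RingHom.id F) = Jstar := by
    ext i k
    rfl
  -- the CM structure of the frame (FILE A) and the special pair (E2, by value)
  have hB : ∀ i k : Fin 2, i ≠ k →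
      (((b : Matrix (Fin 2) (Fin 2) F).map (IsCMField.complexConj F))ᵀ * Jstar.map (RingHom.id F) *
        (b : Matrix (Fin 2) (Fin 2) F)) i k = 0 := by
    intro i k hik
    rw [hJid]
    change (((b : Matrix (Fin 2) (Fin 2) F).map (cmConjRingHom F))ᵀ * Jstar * (b : Matrix (Fin 2) (Fin 2) F)) i k = 0
    rw [transpose_map_mul_mul_apply']
    fin_cases i <;> fin_cases k
    · exact absurd rfl hik
    · change hermForm (cmConjRingHom F) Jstar (fun l => (b : Matrix (Fin 2) (Fin 2) F) l 0)
          (fun l => (b : Matrix (Fin 2) (Fin 2) F) l 1) = 0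
      rw [hb1']; exact hperp
    · change hermForm (cmConjRingHom F) Jstar (fun l => (b : Matrix (Fin 2) (Fin 2) F) l 1)
          (fun l => (b : Matrix (Fin 2) (Fin 2) F) l 0) = 0
      rw [hb1']; exact hperp0
    · exact absurd rfl hik
  obtain ⟨c, hc⟩ := exists_cmStructureV_of_orthogonal Fr b hB
  let Φ' : Fin 2 → CMType F := ![Φ, Ψ]
  have hΦ'0 : Φ' 0 = Φ := rfl
  have hΦ'1 : Φ' 1 = Ψ := rfl
  have hΨ' : ∀ ρ : F →+* ℂ, ρ ∈ (Φ' 1).1 ↔ (ρ ∈ Φ.1 ∧ ρ ≠ ι₁) ∨ ρ = NumberField.ComplexEmbedding.conjugate ι₁ := by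
    intro ρ
    rw [hΦ'1, hΨ ρ, RingHom.comp_id]
  have hsp : c.IsSpecial ⟨J (fun i => ι₁ (w i)), hJC _ hw⟩ Φ' := hJsp w hw b hb1' hperp c hc Φ' hΦ'0 hΨ'
  -- the torus element `t = N_{E♯,Φ}(u)` and the reciprocity element `r = ũ_V(d♯, t)`
  let t : ↥(torusFinAdelic F) :=
    ⟨reflexNormFiniteIdele F Φ (reflexField F Φ ι₁) u, reflexNormFiniteIdele_mem_torusFinAdelic_of_le F Φ (reflexField F Φ ι₁) hEΦ u⟩
  have hbmap : Matrix.GeneralLinearGroup.map (RingHom.id F) b = b := by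
    ext i k
    rfl
  have hact : ∀ x : Fin 2 → F, c.actMatrix x =
      framePV Fr * resMatrix (ratBasis F)
        (((Matrix.GeneralLinearGroup.map (RingHom.id F) b : GL (Fin 2) F) : Matrix (Fin 2) (Fin 2) F) * Matrix.diagonal x *
          (((Matrix.GeneralLinearGroup.map (RingHom.id F) b)⁻¹ : GL (Fin 2) F) : Matrix (Fin 2) (Fin 2) F)) * frameQV Fr := by
    intro x
    rw [hbmap]
    exact actMatrix_eq_frame_of_pinnedV Fr b c hc x
  -- the structure is PINNED on the frame: a constant tuple acts by the scalar `x • 1` read through `Fr`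
  have hpin : ∀ x : F, c.actMatrix (fun _ => x) =
      framePV Fr * resMatrix (ratBasis F) (x • (1 : Matrix (Fin 2) (Fin 2) F)) * frameQV Fr := by
    intro x
    rw [hact]
    congr 2
    have hdiag : (Matrix.diagonal fun _ : Fin 2 => x) = x • (1 : Matrix (Fin 2) (Fin 2) F) := by
      ext i k
      by_cases hik : i = k
      · subst hik; simp
      · simp [Matrix.one_apply_ne hik, hik]
    rw [hdiag, Matrix.mul_smul, Matrix.mul_one, Matrix.smul_mul, ← Units.val_mul, mul_inv_cancel, Units.val_one]
  have hN₀ : ((reflexNormFiniteIdele F (Φ' 0) (reflexField F Φ ι₁) u : (FiniteAdeleRing (𝓞 F) F)ˣ) : FiniteAdeleRing (𝓞 F) F) =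
      ((t : (FiniteAdeleRing (𝓞 F) F)ˣ) : FiniteAdeleRing (𝓞 F) F) := rfl
  have hN₁ : ((reflexNormFiniteIdele F (Φ' 1) (reflexField F Φ ι₁) u : (FiniteAdeleRing (𝓞 F) F)ˣ) : FiniteAdeleRing (𝓞 F) F) =
      ((t : (FiniteAdeleRing (𝓞 F) F)ˣ) : FiniteAdeleRing (𝓞 F) F) *
        ratFiniteAdeleTensorEquiv F (finAdeleToTensor F (RingHom.id F)
          (recipFactor F (finiteIdeleRelNorm F ↥(reflexField F Φ ι₁) u))) := by
    rw [hΦ'1]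
    exact reflexNormFiniteIdele_swap_recipFactor F (RingHom.id F) Φ Ψ (reflexField F Φ ι₁) ι₁ (fun x => rfl) hEΦ hΨE
      (fun ρ hρ => by rw [RingHom.comp_id] at hρ; rw [hρ]; exact hΦ) hΨ u
  have hr : ((auxToGspFinV Fr (d', t) : GL (Fin g ⊕ Fin g) finAdeleQ) : Matrix (Fin g ⊕ Fin g) (Fin g ⊕ Fin g) finAdeleQ) =
      c.cmRecipMatrix Φ' (reflexField F Φ ι₁) u :=
    coe_auxToGspFinV_eq_cmRecipMatrix_of_isDiagTwistGS Fr b hb1' hperp c hact hd' t Φ' (reflexField F Φ ι₁) u hN₀ hN₁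
  -- the scalar `ũ_V(1, t)` is central in the image torus: the SPLIT identity (it is NOT absorbed into any level here)
  -- the scalar `ũ_V(1, t)` is central in the image torus: the SPLIT identity, for every `a`
  have hsplit : ∀ a : ↥(finAdelic (↥(maximalRealSubfield F)) F (IsCMField.complexConj F) 2 Jstar),
      auxToGspFinV Fr (d', t) * auxToGspFinV Fr (a, 1) = auxToGspFinV Fr (d' * a, 1) * auxToGspFinV Fr (1, t) := by
    intro a
    rw [← map_mul, Prod.mk_mul_mk, mul_one, auxToGspFinV_eq_mul, auxToGspFinV_one_mul_comm_one]
  refine ⟨c, Φ', t, d', hsp, hpin, hΦ'0, hΨ', ?_, hr, rfl, ⟨finiteIdeleRelNorm F ↥(reflexField F Φ ι₁) u,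
    fun σ hus => isArtinCorrespondent_finiteIdeleRelNorm F Φ ι₁ σ u hus, hd', hN₁⟩, hsplit⟩
  intro i
  fin_cases i
  · exact hEΦ
  · exact hΨE

/-- **(S2a) AT A GIVEN CORRESPONDENT**: for `σ` fixing `E♯` pointwise and a GIVEN `E♯`-idèle `u ↔ σ`, the datum of `exists_siegelRecipDatum_centralTwist_at`
at `u`, PLUS `s′ = N_{E♯∕F} u ↔ σ` along `ι₁` (★ `isArtinCorrespondent_finiteIdeleRelNorm`) and, for any `F`-correspondent `s ↔ σ` with twist `d`, the
agreement of the twist classes `[ι₁w, d·a]_K = [ι₁w, d♯·a]_K` at every level (★ `shimuraSetGS_mk_twist_eq_of_isArtinCorrespondent'`) — the conclusion of ★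
`exists_siegelRecipDatum_centralTwist` with its `∃ sE` instantiated at the closer's own `sE := u`.
[cite: Milne2005ShimuraVarieties, Def. 12.8 (59)–(62) p. 114, §11 Thm. 11.2 p. 108] [cite: Deligne1971TravauxShimura, 4.18 p. 150 and 5.11 p. 158]
[cite: Shimura1998, §18.6 p. 128] -/
theorem exists_siegelRecipDatum_centralTwist_of_correspondent (ι₁ : F →+* ℂ) (Jstar : Matrix (Fin 2) (Fin 2) F)
    (hJ : (Jstar.map (IsCMField.complexConj F))ᵀ = Jstar) (Φ : CMType F) (hΦ : ι₁ ∈ Φ.1) {ξ : F} {g : ℕ} {δ : Fin g → ℕ}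
    (Fr : SymplecticFrameV F (RingHom.id F) Jstar ξ g δ)
    (J : (Fin 2 → ℂ) → Matrix (Fin g ⊕ Fin g) (Fin g ⊕ Fin g) ℝ)
    (hJC : ∀ v : Fin 2 → ℂ, v ∈ negCone (Jstar.map ι₁) → J v ∈ C0pm δ)
    (hJsp : ∀ (w : Fin 2 → F) (hw : (fun i => ι₁ (w i)) ∈ negCone (Jstar.map ι₁)) (b : GL (Fin 2) F),
      (fun i => (b : Matrix (Fin 2) (Fin 2) F) i 1) = w →
      hermForm (cmConjRingHom F) Jstar (fun i => (b : Matrix (Fin 2) (Fin 2) F) i 0) w = 0 →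
      ∀ c : CMStructure g δ (Fin 2) (fun _ => F),
        (∀ (x : Fin 2 → F) (p : Fin 2) (m : F),
          c.act x (Fr.β (m • (b : Matrix (Fin 2) (Fin 2) F) *ᵥ Pi.single p 1)) =
            Fr.β ((x p * m) • (b : Matrix (Fin 2) (Fin 2) F) *ᵥ Pi.single p 1)) →
        ∀ Φ' : Fin 2 → CMType F, Φ' 0 = Φ →
          (∀ ρ : F →+* ℂ, ρ ∈ (Φ' 1).1 ↔ (ρ ∈ Φ.1 ∧ ρ ≠ ι₁) ∨ ρ = NumberField.ComplexEmbedding.conjugate ι₁) →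
          c.IsSpecial ⟨J (fun i => ι₁ (w i)), hJC _ hw⟩ Φ') :
    haveI : NumberField ↥(reflexField F Φ ι₁) := numberField_reflexField F Φ ι₁
    ∀ σ : ℂ ≃ₐ[ℚ] ℂ, (∀ x : ℂ, x ∈ reflexField F Φ ι₁ → σ x = x) →
      ∀ u : (FiniteAdeleRing (𝓞 ↥(reflexField F Φ ι₁)) ↥(reflexField F Φ ι₁))ˣ,
        IsArtinCorrespondent ↥(reflexField F Φ ι₁) (algebraMap ↥(reflexField F Φ ι₁) ℂ) u σ.toRingEquiv →
      ∀ s : (FiniteAdeleRing (𝓞 F) F)ˣ, IsArtinCorrespondent F ι₁ s σ.toRingEquiv →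
      ∀ (w : Fin 2 → F) (hw : (fun i => ι₁ (w i)) ∈ negCone (Jstar.map ι₁))
        (d : ↥(finAdelic (↥(maximalRealSubfield F)) F (IsCMField.complexConj F) 2 Jstar)),
        IsDiagTwistGS F Jstar w (recipFactor F s) d →
        ∃ (c : CMStructure g δ (Fin 2) (fun _ => F)) (Φ' : Fin 2 → CMType F) (t : ↥(torusFinAdelic F))
          (d' : ↥(finAdelic (↥(maximalRealSubfield F)) F (IsCMField.complexConj F) 2 Jstar)),
          c.IsSpecial ⟨J (fun i => ι₁ (w i)), hJC _ hw⟩ Φ' ∧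
          (∀ x : F, c.actMatrix (fun _ => x) = framePV Fr * resMatrix (ratBasis F) (x • (1 : Matrix (Fin 2) (Fin 2) F)) * frameQV Fr) ∧
          Φ' 0 = Φ ∧ (∀ ρ : F →+* ℂ, ρ ∈ (Φ' 1).1 ↔ (ρ ∈ Φ.1 ∧ ρ ≠ ι₁) ∨ ρ = NumberField.ComplexEmbedding.conjugate ι₁) ∧
          (∀ i, traceField (Φ' i) ≤ reflexField F Φ ι₁) ∧
          ((auxToGspFinV Fr (d', t) : GL (Fin g ⊕ Fin g) finAdeleQ) : Matrix (Fin g ⊕ Fin g) (Fin g ⊕ Fin g) finAdeleQ) =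
            c.cmRecipMatrix Φ' (reflexField F Φ ι₁) u ∧
          (t : (FiniteAdeleRing (𝓞 F) F)ˣ) = reflexNormFiniteIdele F Φ (reflexField F Φ ι₁) u ∧
          (∃ s' : (FiniteAdeleRing (𝓞 F) F)ˣ, IsArtinCorrespondent F ι₁ s' σ.toRingEquiv ∧ IsDiagTwistGS F Jstar w (recipFactor F s') d' ∧
            ((reflexNormFiniteIdele F (Φ' 1) (reflexField F Φ ι₁) u : (FiniteAdeleRing (𝓞 F) F)ˣ) : FiniteAdeleRing (𝓞 F) F) =
              ((t : (FiniteAdeleRing (𝓞 F) F)ˣ) : FiniteAdeleRing (𝓞 F) F) *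
                ratFiniteAdeleTensorEquiv F (finAdeleToTensor F (RingHom.id F) (recipFactor F s'))) ∧
          (∀ a : ↥(finAdelic (↥(maximalRealSubfield F)) F (IsCMField.complexConj F) 2 Jstar),
            auxToGspFinV Fr (d', t) * auxToGspFinV Fr (a, 1) = auxToGspFinV Fr (d' * a, 1) * auxToGspFinV Fr (1, t)) ∧
          ∀ (K : Subgroup ↥(finAdelic (↥(maximalRealSubfield F)) F (IsCMField.complexConj F) 2 Jstar))
            (a : ↥(finAdelic (↥(maximalRealSubfield F)) F (IsCMField.complexConj F) 2 Jstar)),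
            ShimuraSetGS.mk F Jstar ι₁ K (fun i => ι₁ (w i)) hw (d * a) = ShimuraSetGS.mk F Jstar ι₁ K (fun i => ι₁ (w i)) hw (d' * a) := by
  haveI : NumberField ↥(reflexField F Φ ι₁) := numberField_reflexField F Φ ι₁
  intro σ _hσ u hus s hs w hw d hd
  obtain ⟨c, Φ', t, d', hsp, hpin, h0, h1, hE, hr, ht, ⟨s', hs'σ, hd', hN₁⟩, hsplit⟩ :=
    exists_siegelRecipDatum_centralTwist_at ι₁ Jstar hJ Φ hΦ Fr J hJC hJsp u w hw
  have hNu : IsArtinCorrespondent F ι₁ s' σ.toRingEquiv := hs'σ σ.toRingEquiv hus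
  have hww : hermForm (cmConjRingHom F) Jstar w w ≠ 0 :=
    UnitaryCanonicalModel.hermForm_self_ne_zero_of_embedding_mem_negCone hw
  exact ⟨c, Φ', t, d', hsp, hpin, h0, h1, hE, hr, ht, ⟨s', hNu, hd', hN₁⟩, hsplit,
    fun K a => shimuraSetGS_mk_twist_eq_of_isArtinCorrespondent' F Jstar hJ ι₁ K hs hNu hww hw hd hd' a⟩

end AuxV

end UnitaryCurve

end Literature.AlgebraicGeometry.ShimuraVarieties

end
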